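import Summits.ResolutionOfSingularities.ResolutionOfSingularities.Theorems.WeightedInvariantIota3FlagDeltaBridgeFirstMember
import HarnessLib

/-!
# R10c BASE CASE `r₂ = q` OF THE SECOND-MEMBER CLAUSE (PART 5 of the R10b/R10c bridge files): `flagContactFiltration_eq_iSup_of_r₂_eq_q`,
# `second_member_mem_of_r₂_eq_q`, `dominance_of_r₂_eq_q`, `secondMemberClause_of_r₂_eq_q`

**Provenance / honest framing** — as in PART 1 (`…Iota3FlagDeltaBridgeDefs`): VERBATIM PORT of res-L1-w43-idea-2's `section BaseCase` (§3h) and the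
PROVED `r₂ = q` instance of its §4 from `L/res-L1-w43-idea-2/Sketch-R10c.lean` **bc1b8049cc3c1dd2** (1025 l.; the port ceiling — idea-2 lapsed under
D-0145, nothing newer exists), namespace `…LocalEngine.Iota3` (from `…Iota3.JCanCensus`), dealt by res-L1-w43-plan-1 as (F-2) (STATUS 2026-08-27T21:48:33Z;
door `stmt-ResolutionOfSingularities-19897`, SECOND-MEMBER clause of SPEC (Δ12) rev 4 l.223; consumer res-D-brk-1), ported by res-L1-type-o4,
`--supports stmt-ResolutionOfSingularities-19897 --as helper`. [OURS · L1 w43 · idea-2 R10c §3h] OURS elementary commutative algebra over Mathlib and PARTS 1–4.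
**NOT ported: the §4 CANDIDATE `def SecondMemberClause` (an UNPROVED OURS statement — the `r₂ > q` secondary-polygon case is OPEN per the sketch; a
candidate Prop is not a Theorems object), and the sketch's closing doc-carrier.** NOT a statement of H. Hironaka's 2017 manuscript (nothing of it asserted
or used); no Literature fact introduced; AI-written/ported, weaker than expert review; no progress claim. Def-free.

## Contents (verbatim)
`flagContactFiltration_eq_iSup_of_r₂_eq_q` (at `r₂ = q` the two-flag filtration is `⨆_a (g₁^a)·𝔪^⌈(n − r₁a)/q⌉` — the second member is absorbed),
`flagContactFiltration_eq_of_r₂_eq_q`, `second_member_mem_of_r₂_eq_q` (ANY second member `g₂' ∈ 𝔪` lies in `F_(g₁; g₂)(q)` at `r₂ = q`),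
`dominance_of_r₂_eq_q` (the `r₂ = q` dominance in `S₀⟦X⟧` via PART 4), `secondMemberClause_of_r₂_eq_q` (the `r₂ = q` instance of the §4 clause, explicit form).
-/

noncomputable section

open Polynomial IsLocalRing
open Literature.AlgebraicGeometry.Resolution.CossartPiltant
open Summit.ResolutionOfSingularities.ResolutionOfSingularities.Theorems

set_option linter.dupNamespace false

namespace Summit.ResolutionOfSingularities.ResolutionOfSingularities.Cruxes.HypersurfaceCentreConstruction.LocalEngine.Iota3

section BaseCase

variable {S : Type*} [CommRing S] [IsLocalRing S]

/-- Ceiling bookkeeping: `⌈m/q⌉ ≤ β + ⌈(m − qβ)/q⌉`. [folklore] -/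
private theorem ceilDiv_le_add_ceilDiv (m q β : ℕ) (hq : 0 < q) :
    (m + q - 1) / q ≤ β + (m - q * β + q - 1) / q := by
  rcases le_or_gt (q * β) m with h | h
  · have : m + q - 1 = (m - q * β + q - 1) + q * β := by omega
    rw [this, Nat.add_mul_div_left _ _ hq]; omega
  · have h2 : (m + q - 1) / q < β + 1 := by
      rw [Nat.div_lt_iff_lt_mul hq]
      have : (β + 1) * q = q * β + q := by ring
      rw [this]; omega
    exact le_trans (Nat.le_of_lt_succ h2) (Nat.le_add_right _ _)

/-- **§3h BASE CASE `r₂ = q` (R10c · OURS · PROVED).**  When the second member carries the minimal weight `r₂ = q`, the two-flag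
filtration FORGETS the second member: `F_{(g₁; g₂)}^{(q; r₁, q)}(n) = Σ_α (g₁^α)·𝔪^{⌈(n − r₁ α)/q⌉}` for any `g₂ ∈ 𝔪`.  [OURS · R10c §3h] -/
theorem flagContactFiltration_eq_iSup_of_r₂_eq_q (g₁ g₂ : S) (hg₂ : g₂ ∈ maximalIdeal S) (q r₁ n : ℕ) (hq : 0 < q) :
    flagContactFiltration g₁ g₂ q r₁ q n = ⨆ α : ℕ, Ideal.span {g₁ ^ α} * maximalIdeal S ^ ((n - r₁ * α + q - 1) / q) := by
  rw [flagContactFiltration_def]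
  apply le_antisymm
  · refine iSup₂_le fun α β => ?_
    refine le_trans ?_ (le_iSup _ α)
    calc Ideal.span {g₁ ^ α * g₂ ^ β} * maximalIdeal S ^ ((n - r₁ * α - q * β + q - 1) / q)
        = Ideal.span {g₁ ^ α} * (Ideal.span {g₂ ^ β} * maximalIdeal S ^ ((n - r₁ * α - q * β + q - 1) / q)) := by
          rw [← Ideal.span_singleton_mul_span_singleton, mul_assoc]
      _ ≤ Ideal.span {g₁ ^ α} * (maximalIdeal S ^ β * maximalIdeal S ^ ((n - r₁ * α - q * β + q - 1) / q)) := by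
          apply Ideal.mul_mono_right; apply Ideal.mul_mono_left
          rw [Ideal.span_singleton_le_iff_mem]; exact Ideal.pow_mem_pow hg₂ β
      _ = Ideal.span {g₁ ^ α} * maximalIdeal S ^ (β + (n - r₁ * α - q * β + q - 1) / q) := by rw [← pow_add]
      _ ≤ Ideal.span {g₁ ^ α} * maximalIdeal S ^ ((n - r₁ * α + q - 1) / q) := by
          apply Ideal.mul_mono_right
          exact Ideal.pow_le_pow_right (ceilDiv_le_add_ceilDiv (n - r₁ * α) q β hq)
  · refine iSup_le fun α => ?_
    refine le_trans ?_ (le_iSup₂ (f := fun α β => Ideal.span {g₁ ^ α * g₂ ^ β} *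
      maximalIdeal S ^ ((n - r₁ * α - q * β + q - 1) / q)) α 0)
    simp

/-- `r₂ = q`: the filtration does not depend on the second member. [OURS · R10c §3h] -/
theorem flagContactFiltration_eq_of_r₂_eq_q (g₁ g₂ g₂' : S) (hg₂ : g₂ ∈ maximalIdeal S) (hg₂' : g₂' ∈ maximalIdeal S)
    (q r₁ n : ℕ) (hq : 0 < q) :
    flagContactFiltration g₁ g₂ q r₁ q n = flagContactFiltration g₁ g₂' q r₁ q n := by
  rw [flagContactFiltration_eq_iSup_of_r₂_eq_q g₁ g₂ hg₂ q r₁ n hq, flagContactFiltration_eq_iSup_of_r₂_eq_q g₁ g₂' hg₂' q r₁ n hq]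

/-- `r₂ = q`: the SECOND-MEMBER clause of dominance is free — every `g₂' ∈ 𝔪` lies in `F_{(g₁; g₂)}(q)`. [OURS · R10c §3h] -/
theorem second_member_mem_of_r₂_eq_q (g₁ g₂ g₂' : S) (hg₂ : g₂ ∈ maximalIdeal S) (hg₂' : g₂' ∈ maximalIdeal S)
    (q r₁ : ℕ) (hq : 0 < q) :
    g₂' ∈ flagContactFiltration g₁ g₂ q r₁ q q := by
  rw [flagContactFiltration_eq_iSup_of_r₂_eq_q g₁ g₂ hg₂ q r₁ q hq]
  refine Ideal.mem_iSup_of_mem 0 ?_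
  have h1 : (q - r₁ * 0 + q - 1) / q = 1 := by
    rw [mul_zero, Nat.sub_zero]
    have : q + q - 1 = q * 1 + (q - 1) := by omega
    rw [this, Nat.mul_add_div hq, Nat.div_eq_of_lt (by omega)]
  rw [pow_zero, Ideal.span_singleton_one, Ideal.top_mul, h1, pow_one]
  exact hg₂'

/-- **§3h FULL DOMINANCE AT `r₂ = q` (R10c · OURS · PROVED; `S₀` complete).**  In the model `S₀⟦X⟧` with the hub flag `(X; C u₁)` (`h` minimal),
at every admissible triple with `r₂ = q` BOTH clauses of SPEC rev 4 l.223 hold for EVERY competing two-flag `(g₁'; g₂')` with `g₂' ∈ 𝔪`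
and `g₁'` of X-order one: reaching ⇒ `g₁' ∈ F_hub(r₁)` and `g₂' ∈ F_hub(q)`.  (By §3h the second member is invisible at `r₂ = q`, so §3g
applies to `(g₁'; C u₁)`.)  [OURS · R10c §3h · PROVED · not expert-reviewed] -/
theorem dominance_of_r₂_eq_q {S₀ : Type*} [CommRing S₀] [IsLocalRing S₀] [IsNoetherianRing S₀] [IsAdicComplete (maximalIdeal S₀) S₀] (u : Fin 2 → S₀)
    (hm : maximalIdeal S₀ = Ideal.span (Set.range u))
    (H : ∀ (i : Fin 2) (T : Finset (Fin 2)), i ∉ T →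
      ∀ y, u i * y ∈ Ideal.span (u '' ↑T) → y ∈ Ideal.span (u '' ↑T))
    (hrad : (Ideal.span (Set.range u)).IsRadical)
    {h : S₀[X]} (hh : h.Monic) (hm1 : 1 ≤ h.natDegree) (hmin : IsMinimal u h)
    {q r₁ : ℕ} (hadm : AdmissibleTriple q r₁ q) {g₁ g₂ : PowerSeries S₀}
    (hg0 : PowerSeries.constantCoeff g₁ ∈ maximalIdeal S₀) (hg1 : PowerSeries.coeff 1 g₁ ∉ maximalIdeal S₀)
    (hg₂ : g₂ ∈ maximalIdeal (PowerSeries S₀))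
    (hreach : (h : PowerSeries S₀) ∈ flagContactFiltration g₁ g₂ q r₁ q (r₁ * h.natDegree)) :
    g₁ ∈ flagContactFiltration (PowerSeries.X : PowerSeries S₀) (PowerSeries.C (u 1)) q r₁ q r₁ ∧
      g₂ ∈ flagContactFiltration (PowerSeries.X : PowerSeries S₀) (PowerSeries.C (u 1)) q r₁ q q := by
  have hq : 0 < q := hadm.1
  have hCu : PowerSeries.C (u 1) ∈ maximalIdeal (PowerSeries S₀) := by
    rw [mem_maximalIdeal_powerSeries_iff, PowerSeries.constantCoeff_C, hm]
    exact Ideal.subset_span ⟨1, rfl⟩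
  refine ⟨?_, second_member_mem_of_r₂_eq_q _ _ _ hCu hg₂ q r₁ hq⟩
  rw [flagContactFiltration_eq_of_r₂_eq_q g₁ g₂ (PowerSeries.C (u 1)) hg₂ hCu q r₁ _ hq] at hreach
  exact first_member_mem_of_flag_reaches u hm H hrad hh hm1 hmin hadm hg0 hg1 hreach

end BaseCase

section NextTarget

/-- The `r₂ = q` instance of §4 is §3h (no maximality, minimality or flag hypothesis needed there). [OURS · R10c §4 · PROVED] -/
theorem secondMemberClause_of_r₂_eq_q {S₀ : Type*} [CommRing S₀] [IsLocalRing S₀] (u : Fin 2 → S₀)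
    (hm : maximalIdeal S₀ = Ideal.span (Set.range u)) {q r₁ : ℕ} (hadm : AdmissibleTriple q r₁ q) {y' : S₀}
    (hy' : y' ∈ maximalIdeal S₀) :
    PowerSeries.C y' ∈ flagContactFiltration (PowerSeries.X : PowerSeries S₀) (PowerSeries.C (u 1)) q r₁ q q := by
  have hCu : PowerSeries.C (u 1) ∈ maximalIdeal (PowerSeries S₀) := by
    rw [mem_maximalIdeal_powerSeries_iff, PowerSeries.constantCoeff_C, hm]
    exact Ideal.subset_span ⟨1, rfl⟩
  have hCy : PowerSeries.C y' ∈ maximalIdeal (PowerSeries S₀) := by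
    rw [mem_maximalIdeal_powerSeries_iff, PowerSeries.constantCoeff_C]; exact hy'
  exact second_member_mem_of_r₂_eq_q _ _ _ hCu hCy q r₁ hadm.1

end NextTarget
end Summit.ResolutionOfSingularities.ResolutionOfSingularities.Cruxes.HypersurfaceCentreConstruction.LocalEngine.Iota3
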